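import Literature.Analysis.FluidPDE.Tao2016AveragedNS.GateRetuning
import HarnessLib

/-!
# Tao 2016, §5.5 — coordinatewise (cascade) displacement bounds for the retuned delay circuit

T. Tao, *Finite time blowup for an averaged three-dimensional Navier–Stokes equation*, J. Amer.
Math. Soc. **29** (2016) 601–674 = arXiv:1402.0290, §5.5 (the five-mode delay circuit (5.5):
`∂ₜa = -ε⁻²cd - εab - ε²e^{-K¹⁰}ac`, `∂ₜb = εa² - ε⁻¹K¹⁰c²`, `∂ₜc = ε²e^{-K¹⁰}a² + ε⁻¹K¹⁰bc`,
`∂ₜd = ε⁻²ca - Kdã`, `∂ₜã = Kd²`); E. Hairer, S. P. Nørsett, G. Wanner, *Solving ODE I* (2nd ed.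
1993), §I.10, Theorem 10.2 (the fundamental lemma / Grönwall).

HONEST FRAMING (cell pub-fluidc, blueprint seat 1): low prior, high value-of-information
experiment on Tao's machine paradigm; NOT a claim that NS blows up. No Navier–Stokes statement
here. This file is the second step of the cell's "structured tube" programme
(`pub-fluidc-bp1/SPEC-INPUT-bp1.md` (D); first step `StructuredPairing.lean`): for two exact
trajectories `X`, `Y` of a member `delayCircuitWith K M ε` of the retuned family
(`GateRetuning.lean`; Tao's (5.5) is `M = K¹⁰`), the displacement of EACH coordinate obeys its
own scalar Grönwall inequality whose RATE is a coupling times a coordinate of the running state —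
not the generic Lipschitz constant `≍ ε⁻²` of the whole field — and whose FORCING comes from the
displacements of the upstream coordinates only:

* `abs_sub_apply_le_gronwallBound` — the engine: if `F(Y)ᵢ - F(X)ᵢ = r(s)·(Yᵢ - Xᵢ) + g(s)` along
  the two trajectories with `|r| ≤ Λ`, `|g| ≤ φ` on `[0,T)`, then `|Yᵢ - Xᵢ| ≤ gronwallBound δ₀ Λ φ t`;
* `trigger_sub_le_gronwallBound` (`c`, index 2): rate `|ε⁻¹M|·sup|Y_b|`, forcing from `W_a, W_b`
  — NO rotor term (the trigger drives the rotor and receives nothing back);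
* `rotated_sub_le_gronwallBound` (`d`, index 3): rate `|K|·sup|Y_ã|`, forcing
  `ε⁻²(Y_a W_c + X_c W_a) - K X_d W_ã` — the `ε⁻²` enters as FORCING by the trigger displacement,
  i.e. linearly in time, not in the exponent;
* `output_sub_le` (`ã`, index 4): no rate, forcing `K(X_d + Y_d)W_d`: `|W_ã| ≤ δ₀ + φt`;
* `clock_sub_le` (`b`, index 1): no rate, forcing `ε(X_a+Y_a)W_a - ε⁻¹M(X_c+Y_c)W_c`;
* `carrier_sub_le_gronwallBound` (`a`, index 0): rate `|ε|·sup|Y_b| + ε²e^{-M}·sup|Y_c|`, forcing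
  `-ε⁻²(Y_d W_c + X_c W_d) - εX_a W_b - ε²e^{-M} X_a W_c`.

Reading (no dynamics of Theorem 5.3 is used or claimed): on the quiet phase of the reference
trajectory (`|b| ≲ ε t`, `|c|, |d|, |ã|` tiny) every RATE above is `O(M)` or smaller, so each
coordinate's own amplification factor over a unit window is `e^{O(M)} = K^{O(p)}` on `M = p log K`;
the `ε⁻²` of the generic tube appears only as the gain of the one-way feed `c → d` (and `(c,d) → a`).
Closing the loop (the forcings reference each other) is the perturbative bootstrap the cell calls
"Theorem 5.3 for pseudo-orbits"; this file supplies its five scalar inequalities.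
-/

namespace Literature.Analysis.FluidPDE.Tao2016AveragedNS

open Set

variable {m : ℕ}

/-! ## The scalar engine -/

/-- A coordinate of a differentiable trajectory is differentiable with the corresponding
coordinate of the velocity. [folklore] -/
theorem hasDerivAt_coord {X : ℝ → Fin m → ℝ} {V : Fin m → ℝ} {t : ℝ} (hX : HasDerivAt X V t)
    (i : Fin m) : HasDerivAt (fun s => X s i) (V i) t :=
  (hasDerivAt_pi.1 hX) i

/-- **Scalar Grönwall engine for one coordinate of two trajectories.** If along two exact
trajectories `X`, `Y` of the same field `F` the `i`-th increment splits as
`F(Y s)ᵢ - F(X s)ᵢ = r s · (Y s i - X s i) + g s` with `|r| ≤ Λ` and `|g| ≤ φ` on `[0,T)`, and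
`|Y 0 i - X 0 i| ≤ δ₀`, then `|Y t i - X t i| ≤ gronwallBound δ₀ Λ φ t` on `[0,T]`.
[cite: HairerNorsettWanner1993, Thm I.10.2] -/
theorem abs_sub_apply_le_gronwallBound {F : (Fin m → ℝ) → (Fin m → ℝ)} {X Y : ℝ → Fin m → ℝ}
    (hX : ∀ t, HasDerivAt X (F (X t)) t) (hY : ∀ t, HasDerivAt Y (F (Y t)) t) (i : Fin m)
    {T δ₀ Λ φ : ℝ} (r g : ℝ → ℝ)
    (hsplit : ∀ s, F (Y s) i - F (X s) i = r s * (Y s i - X s i) + g s)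
    (hr : ∀ s ∈ Ico 0 T, |r s| ≤ Λ) (hg : ∀ s ∈ Ico 0 T, |g s| ≤ φ)
    (h0 : |Y 0 i - X 0 i| ≤ δ₀) :
    ∀ t ∈ Icc 0 T, |Y t i - X t i| ≤ gronwallBound δ₀ Λ φ t := by
  have hd : ∀ s, HasDerivAt (fun s => Y s i - X s i) (F (Y s) i - F (X s) i) s :=
    fun s => (hasDerivAt_coord (hY s) i).sub (hasDerivAt_coord (hX s) i)
  have key := norm_le_gronwallBound_of_norm_deriv_right_le (f := fun s => Y s i - X s i)
    (f' := fun s => F (Y s) i - F (X s) i) (δ := δ₀) (K := Λ) (ε := φ) (a := 0) (b := T)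
    (fun s _ => (hd s).continuousAt.continuousWithinAt)
    (fun s _ => (hd s).hasDerivWithinAt) (by simpa [Real.norm_eq_abs] using h0) ?_
  · intro t ht
    simpa [Real.norm_eq_abs] using key t ht
  · intro s hs
    rw [Real.norm_eq_abs, Real.norm_eq_abs, hsplit s]
    calc |r s * (Y s i - X s i) + g s| ≤ |r s * (Y s i - X s i)| + |g s| := abs_add_le _ _
      _ = |r s| * |Y s i - X s i| + |g s| := by rw [abs_mul]
      _ ≤ Λ * |Y s i - X s i| + φ := by gcongr; exact hr s hs; exact hg s hs

/-- With no rate the Grönwall bound is affine: `gronwallBound δ₀ 0 φ t = δ₀ + φ t`. [folklore] -/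
theorem gronwallBound_rate_zero (δ₀ φ t : ℝ) : gronwallBound δ₀ 0 φ t = δ₀ + φ * t :=
  congrFun (gronwallBound_K0 δ₀ φ) t

/-! ## The five coordinates of the retuned circuit -/

section circuit

variable {K M ε : ℝ} {X Y : ℝ → Fin 5 → ℝ}
  (hX : ∀ t, HasDerivAt X (delayCircuitWith K M ε (X t)) t)
  (hY : ∀ t, HasDerivAt Y (delayCircuitWith K M ε (Y t)) t)
include hX hY

/-- **Trigger coordinate `c` (index 2).** The increment splits as
`ε⁻¹M·Y_b·W_c + [ε²e^{-M}(X_a + Y_a)W_a + ε⁻¹M·X_c·W_b]` — no rotor term. Hence with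
`|Y_b| ≤ β` on `[0,T)` (rate `|ε⁻¹M|β`) and the bracket bounded by `φ`:
`|Y t 2 - X t 2| ≤ gronwallBound δ₀ (|ε⁻¹M|β) φ t`. [cite: Tao2016AveragedNS, §5.5 (5.5)] -/
theorem trigger_sub_le_gronwallBound {T δ₀ β φ : ℝ} (hb : ∀ s ∈ Ico 0 T, |Y s 1| ≤ β)
    (hφ : ∀ s ∈ Ico 0 T,
      |ε ^ 2 * Real.exp (-M) * (X s 0 + Y s 0) * (Y s 0 - X s 0) +
        ε⁻¹ * M * X s 2 * (Y s 1 - X s 1)| ≤ φ)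
    (h0 : |Y 0 2 - X 0 2| ≤ δ₀) :
    ∀ t ∈ Icc 0 T, |Y t 2 - X t 2| ≤ gronwallBound δ₀ (|ε⁻¹ * M| * β) φ t := by
  refine abs_sub_apply_le_gronwallBound hX hY 2 (fun s => ε⁻¹ * M * Y s 1)
    (fun s => ε ^ 2 * Real.exp (-M) * (X s 0 + Y s 0) * (Y s 0 - X s 0) +
      ε⁻¹ * M * X s 2 * (Y s 1 - X s 1)) (fun s => ?_) (fun s hs => ?_) hφ h0
  · simp [delayCircuitWith]; ring
  · rw [abs_mul]; exact mul_le_mul_of_nonneg_left (hb s hs) (abs_nonneg _)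

/-- **Rotated coordinate `d` (index 3).** The increment splits as
`-K·Y_ã·W_d + [ε⁻²(Y_a W_c + X_c W_a) - K X_d W_ã]`: rate `|K|·sup|Y_ã|`, and the `ε⁻²` appears
only in the FORCING by the trigger displacement `W_c` (one-way feed `c → d`).
[cite: Tao2016AveragedNS, §5.5 (5.5)] -/
theorem rotated_sub_le_gronwallBound {T δ₀ α φ : ℝ} (hã : ∀ s ∈ Ico 0 T, |Y s 4| ≤ α)
    (hφ : ∀ s ∈ Ico 0 T,
      |(ε ^ 2)⁻¹ * (Y s 0 * (Y s 2 - X s 2) + X s 2 * (Y s 0 - X s 0)) -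
        K * X s 3 * (Y s 4 - X s 4)| ≤ φ)
    (h0 : |Y 0 3 - X 0 3| ≤ δ₀) :
    ∀ t ∈ Icc 0 T, |Y t 3 - X t 3| ≤ gronwallBound δ₀ (|K| * α) φ t := by
  refine abs_sub_apply_le_gronwallBound hX hY 3 (fun s => -(K * Y s 4))
    (fun s => (ε ^ 2)⁻¹ * (Y s 0 * (Y s 2 - X s 2) + X s 2 * (Y s 0 - X s 0)) -
      K * X s 3 * (Y s 4 - X s 4)) (fun s => ?_) (fun s hs => ?_) hφ h0
  · simp [delayCircuitWith]; ring
  · rw [abs_neg, abs_mul]; exact mul_le_mul_of_nonneg_left (hã s hs) (abs_nonneg _)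

/-- **Output coordinate `ã` (index 4).** The increment is pure forcing `K(X_d + Y_d)W_d`:
`|Y t 4 - X t 4| ≤ δ₀ + φt`. [cite: Tao2016AveragedNS, §5.5 (5.5)] -/
theorem output_sub_le {T δ₀ φ : ℝ}
    (hφ : ∀ s ∈ Ico 0 T, |K * (X s 3 + Y s 3) * (Y s 3 - X s 3)| ≤ φ)
    (h0 : |Y 0 4 - X 0 4| ≤ δ₀) :
    ∀ t ∈ Icc 0 T, |Y t 4 - X t 4| ≤ δ₀ + φ * t := by
  intro t ht
  have h := abs_sub_apply_le_gronwallBound hX hY 4 (Λ := 0) (fun _ => 0)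
    (fun s => K * (X s 3 + Y s 3) * (Y s 3 - X s 3)) (fun s => ?_) (fun s _ => by simp) hφ h0 t ht
  · simpa [gronwallBound_rate_zero] using h
  · simp [delayCircuitWith]; ring

/-- **Clock coordinate `b` (index 1).** Pure forcing `ε(X_a + Y_a)W_a - ε⁻¹M(X_c + Y_c)W_c`:
`|Y t 1 - X t 1| ≤ δ₀ + φt`. [cite: Tao2016AveragedNS, §5.5 (5.5)] -/
theorem clock_sub_le {T δ₀ φ : ℝ}
    (hφ : ∀ s ∈ Ico 0 T,
      |ε * (X s 0 + Y s 0) * (Y s 0 - X s 0) - ε⁻¹ * M * (X s 2 + Y s 2) * (Y s 2 - X s 2)| ≤ φ)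
    (h0 : |Y 0 1 - X 0 1| ≤ δ₀) :
    ∀ t ∈ Icc 0 T, |Y t 1 - X t 1| ≤ δ₀ + φ * t := by
  intro t ht
  have h := abs_sub_apply_le_gronwallBound hX hY 1 (Λ := 0) (fun _ => 0)
    (fun s => ε * (X s 0 + Y s 0) * (Y s 0 - X s 0) - ε⁻¹ * M * (X s 2 + Y s 2) * (Y s 2 - X s 2))
    (fun s => ?_) (fun s _ => by simp) hφ h0 t ht
  · simpa [gronwallBound_rate_zero] using h
  · simp [delayCircuitWith]; ring

/-- **Carrier coordinate `a` (index 0).** The increment splits as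
`-(εY_b + ε²e^{-M}Y_c)·W_a + [-ε⁻²(Y_d W_c + X_c W_d) - εX_a W_b - ε²e^{-M}X_a W_c]`: rate
`|ε|β + ε²e^{-M}γ` from `|Y_b| ≤ β`, `|Y_c| ≤ γ`. [cite: Tao2016AveragedNS, §5.5 (5.5)] -/
theorem carrier_sub_le_gronwallBound {T δ₀ β γ φ : ℝ} (hb : ∀ s ∈ Ico 0 T, |Y s 1| ≤ β)
    (hc : ∀ s ∈ Ico 0 T, |Y s 2| ≤ γ)
    (hφ : ∀ s ∈ Ico 0 T,
      |-((ε ^ 2)⁻¹ * (Y s 3 * (Y s 2 - X s 2) + X s 2 * (Y s 3 - X s 3))) -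
        ε * X s 0 * (Y s 1 - X s 1) - ε ^ 2 * Real.exp (-M) * X s 0 * (Y s 2 - X s 2)| ≤ φ)
    (h0 : |Y 0 0 - X 0 0| ≤ δ₀) :
    ∀ t ∈ Icc 0 T, |Y t 0 - X t 0| ≤
      gronwallBound δ₀ (|ε| * β + ε ^ 2 * Real.exp (-M) * γ) φ t := by
  refine abs_sub_apply_le_gronwallBound hX hY 0
    (fun s => -(ε * Y s 1 + ε ^ 2 * Real.exp (-M) * Y s 2))
    (fun s => -((ε ^ 2)⁻¹ * (Y s 3 * (Y s 2 - X s 2) + X s 2 * (Y s 3 - X s 3))) -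
      ε * X s 0 * (Y s 1 - X s 1) - ε ^ 2 * Real.exp (-M) * X s 0 * (Y s 2 - X s 2))
    (fun s => ?_) (fun s hs => ?_) hφ h0
  · simp [delayCircuitWith]; ring
  · have hexp : 0 ≤ ε ^ 2 * Real.exp (-M) := by positivity
    rw [abs_neg]
    calc |ε * Y s 1 + ε ^ 2 * Real.exp (-M) * Y s 2|
        ≤ |ε * Y s 1| + |ε ^ 2 * Real.exp (-M) * Y s 2| := abs_add_le _ _
      _ = |ε| * |Y s 1| + ε ^ 2 * Real.exp (-M) * |Y s 2| := by
          rw [abs_mul, abs_mul, abs_of_nonneg hexp]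
      _ ≤ |ε| * β + ε ^ 2 * Real.exp (-M) * γ := by
          gcongr; exact hb s hs; exact hc s hs

end circuit

/-! ## Tao's member -/

/-- The trigger bound for (5.5) itself (`M = K¹⁰`): rate `|ε⁻¹K¹⁰|·sup|Y_b|`, no rotor term.
[cite: Tao2016AveragedNS, §5.5 (5.5)] -/
theorem trigger_sub_le_gronwallBound_delayCircuit {K ε : ℝ} {X Y : ℝ → Fin 5 → ℝ}
    (hX : ∀ t, HasDerivAt X (delayCircuit K ε (X t)) t)
    (hY : ∀ t, HasDerivAt Y (delayCircuit K ε (Y t)) t) {T δ₀ β φ : ℝ}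
    (hb : ∀ s ∈ Ico 0 T, |Y s 1| ≤ β)
    (hφ : ∀ s ∈ Ico 0 T,
      |ε ^ 2 * Real.exp (-K ^ 10) * (X s 0 + Y s 0) * (Y s 0 - X s 0) +
        ε⁻¹ * K ^ 10 * X s 2 * (Y s 1 - X s 1)| ≤ φ)
    (h0 : |Y 0 2 - X 0 2| ≤ δ₀) :
    ∀ t ∈ Icc 0 T, |Y t 2 - X t 2| ≤ gronwallBound δ₀ (|ε⁻¹ * K ^ 10| * β) φ t := by
  rw [← delayCircuitWith_pow_ten] at hX hY
  exact trigger_sub_le_gronwallBound hX hY hb hφ h0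

end Literature.Analysis.FluidPDE.Tao2016AveragedNS
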